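import Mathlib
import Summits.ResolutionOfSingularities.ResolutionOfSingularities.Theorems.RadicialJungCleanModelsCleanProp44GammaPrimeExceptional
import Summits.ResolutionOfSingularities.ResolutionOfSingularities.Theorems.RadicialJungCleanModelsCleanProp44GammaPrimeTransversal
import HarnessLib

/-!
# Route `RadicialJung`, crux `CleanModels` (stmt-ResolutionOfSingularities-15917), line `Sketch` rev 35, stub 6 `stub_cleanProp44` (X44c):
# THE ADAPTED REGULAR SYSTEM `(e′, z_Γ, π♯w)` AT A POINT OF `Γ′` — census item (v) turnkey for ✓ `…_or_obstruction_of_sides_general`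

Seat decomp-res-hand-2 g20 (structural hand).  Packaging of ✓ `IsBlowup.exists_isRsopPart_unramified_exceptional_of_isNear_curve`
(`…CleanProp44GammaPrimeExceptional.lean`: the pair inside `𝔭_{η′}`, unramifiedness, the exceptional parameter) with the Nakayama transversality
✓ `map_not_mem_sup_sq_of_unramified` (`…CleanProp44GammaPrimeTransversal.lean`) and the tree's «a height-`2` prime containing an rsop pair is generated
by it» (✓ `IsRsopPart.span_range_eq_of_le_of_height_le`, ✓ `IsBlowup.coheight_eq_two_of_isNear_curve_generic`):

* `IsBlowup.exists_adapted_triple_gammaPrime` — at a point `z` of the horizontal successor `Γ′ = cl{η′}` of the curve centre `Y` with `𝔭_{η′} ≠ 𝔪_z`,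
  for every parameter `w ∈ 𝔪_x` along `Y` (`𝔪_x ⊆ 𝓘_{Y,x} + (w)`): `e′, z_Γ` with `(e′) = 𝓘_{Y,x} 𝒪_{X′,z}`, `(e′, z_Γ) = 𝔭_{η′}`, `(e′, z_Γ, π♯w) = 𝔪_z`,
  `π♯w ∉ 𝔭_{η′} + 𝔪_z²`, `π♯w ∉ 𝔭_{η′}` — exactly the data `he'`/`hzz` of hand-2 g19's ✓ `cleanPermissibleAt_exceptionalCurve_or_obstruction_of_sides_general`
  for the curve `N = 𝔭_{η′} = 𝓘_{Γ′,z}`, in which the `w`-side can then only be a side of a CORNER (never tangent, never inside `N`).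

Honest framing: OURS (packaging); nothing here proves X44c, any case of `CleanModels`, or resolution of singularities in characteristic `p`.
[cite: CossartPiltant2008, Lemma 4.3 (4)] [cite: Matsumura1987, Thm. 14.2]
-/

noncomputable section

set_option linter.dupNamespace false -- mandated namespace of this single-conjunct summit

open CategoryTheory AlgebraicGeometry TopologicalSpace IsLocalRing
open Literature.AlgebraicGeometry.Resolution
open Scheme.IdealSheafData

namespace Summit.ResolutionOfSingularities.ResolutionOfSingularities.Theorems.RadicialJung.CleanModels

universe u

variable {X X' : Scheme.{u}} {π : X' ⟶ X}

/-- **THE ADAPTED TRIPLE `(e′, z_Γ, π♯w)` AT A POINT OF `Γ′`.**  `X` regular locally Noetherian, `π` the blowing up of the regular irreducible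
codimension-`2` centre `Y ⊆ {ord J = μ}` (`μ ≥ 1`), `η′` near over the generic point of `Y`, `η′ ⤳ z` with `𝔭_{η′} ≠ 𝔪_z`, and `w ∈ 𝔪_{π z}` with
`𝔪_{π z} ⊆ 𝓘_{Y,π z} + (w)`.  Then there are `e′, z_Γ ∈ 𝒪_{X′,z}` with `(e′) = 𝓘_{Y,π z} 𝒪_{X′,z}` (the exceptional parameter), `(e′, z_Γ) = 𝔭_{η′}`
(the ideal of `Γ′` at `z`), `(e′, z_Γ, π♯w) = 𝔪_z` (a regular system of parameters adapted to `Γ′` with third member the `w`-side), and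
`π♯w ∉ 𝔭_{η′} + 𝔪_z²`, `π♯w ∉ 𝔭_{η′}`. [cite: CossartPiltant2008, Lemma 4.3 (4)] [cite: Matsumura1987, Thm. 14.2] -/
theorem _root_.Literature.AlgebraicGeometry.Resolution.IsBlowup.exists_adapted_triple_gammaPrime
    [IsLocallyNoetherian X] [IsLocallyNoetherian X'] (hX : Scheme.IsRegular X) {Y : Closeds X}
    (hreg : Scheme.IsRegular (vanishingIdeal Y).subscheme) (hπ : IsBlowup π (vanishingIdeal Y))
    {J : X.IdealSheafData} {μ : ℕ} (hμ : 1 ≤ μ) (hY : ∀ y ∈ (Y : Set X), idealOrder J y = μ)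
    {η' : X'} (hη' : closure {π η'} = (Y : Set X)) (hcodim : Order.coheight (π η') = 2)
    (hnear : IsNear π (vanishingIdeal Y) J μ η') {z : X'} (hz : η' ⤳ z)
    (hne : primeOfSpecializes hz ≠ maximalIdeal (X'.presheaf.stalk z)) {w : X.presheaf.stalk (π z)}
    (hwm : w ∈ maximalIdeal (X.presheaf.stalk (π z)))
    (hw : maximalIdeal (X.presheaf.stalk (π z)) ≤ stalkIdeal (vanishingIdeal Y) (π z) ⊔ Ideal.span {w}) :
    ∃ e' zΓ : X'.presheaf.stalk z,
      Ideal.span {e'} = (stalkIdeal (vanishingIdeal Y) (π z)).map (π.stalkMap z).hom ∧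
      Ideal.span ({e', zΓ} : Set (X'.presheaf.stalk z)) = primeOfSpecializes hz ∧
      Ideal.span ({e', zΓ, (π.stalkMap z).hom w} : Set (X'.presheaf.stalk z)) = maximalIdeal (X'.presheaf.stalk z) ∧
      (π.stalkMap z).hom w ∉ primeOfSpecializes hz ⊔ maximalIdeal (X'.presheaf.stalk z) ^ 2 ∧
      (π.stalkMap z).hom w ∉ primeOfSpecializes hz := by
  obtain ⟨v, hv, hvP, hmapP, hunr, he'⟩ :=
    hπ.exists_isRsopPart_unramified_exceptional_of_isNear_curve hX hreg hμ hY hη' hcodim hnear hz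
  have hc : Order.coheight η' = 2 := hπ.coheight_eq_two_of_isNear_curve_generic hX hreg hμ hY hη' hcodim hnear
  have hP2 : (primeOfSpecializes hz).height ≤ 2 := by
    have hh := coe_height_primeOfSpecializes hz
    rw [hc] at hh
    have : ((primeOfSpecializes hz).height : WithBot ℕ∞) = ((2 : ℕ∞) : WithBot ℕ∞) := by exact_mod_cast hh
    exact le_of_eq (by exact_mod_cast this)
  have hspan : Ideal.span (Set.range v) = primeOfSpecializes hz := hv.span_range_eq_of_le_of_height_le hvP hP2
  have hrange : Set.range v = {v 0, v 1} := by
    ext r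
    simp only [Set.mem_range, Set.mem_insert_iff, Set.mem_singleton_iff]
    constructor
    · rintro ⟨i, rfl⟩
      fin_cases i
      · exact Or.inl rfl
      · exact Or.inr rfl
    · rintro (rfl | rfl)
      · exact ⟨0, rfl⟩
      · exact ⟨1, rfl⟩
  rw [hrange] at hspan
  have htrans := map_not_mem_sup_sq_of_unramified (π.stalkMap z).hom hw hmapP hunr
    (IsLocalRing.le_maximalIdeal (Ideal.IsPrime.ne_top inferInstance)) hne
  refine ⟨v 0, v 1, he', hspan, ?_, htrans.1, htrans.2⟩
  have hPle : primeOfSpecializes hz ≤ maximalIdeal (X'.presheaf.stalk z) :=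
    IsLocalRing.le_maximalIdeal (Ideal.IsPrime.ne_top inferInstance)
  have key : Ideal.span ({v 0, v 1, (π.stalkMap z).hom w} : Set (X'.presheaf.stalk z)) =
      primeOfSpecializes hz ⊔ Ideal.span {(π.stalkMap z).hom w} := by
    have hset : ({v 0, v 1, (π.stalkMap z).hom w} : Set (X'.presheaf.stalk z)) = {v 0, v 1} ∪ {(π.stalkMap z).hom w} := by
      ext r
      simp only [Set.mem_insert_iff, Set.mem_singleton_iff, Set.mem_union]
      tauto
    rw [hset, Ideal.span_union, hspan]
  rw [key]
  apply le_antisymm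
  · exact sup_le hPle ((Ideal.span_singleton_le_iff_mem _).mpr (map_nonunit (π.stalkMap z).hom w hwm))
  · exact maximalIdeal_le_sup_span_of_unramified (π.stalkMap z).hom hw hmapP hunr

end Summit.ResolutionOfSingularities.ResolutionOfSingularities.Theorems.RadicialJung.CleanModels

end
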